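import Literature.AnabelianGeometry.SemiGraphs.TemperedCompactPairSparse
import Literature.AnabelianGeometry.SemiGraphs.MetabelianLeafStarElevated
import HarnessLib

/-!
# Every leaf-star of groups is SPARSE: the class theorem of `TemperedCompactPairSparse.lean` re-derives, at the
# canonical chart of the rayless star `𝒢⋆(p)`, the ISOLATION / SENTENCE-2 results of abc-iut-L3-t8 gen 9 by the
# generic route (cross-check instance, no carrier-specific character bookkeeping)

Mochizuki, *Semi-graphs of anabelioids*, Publ. RIMS **42** (2006), §3, Theorem 3.7 (iv) p. 41: "The maximal
compact subgroups of `π₁^temp(𝒢)` are precisely the verticial subgroups. The nontrivial intersections of two distinct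
maximal compact subgroups of `π₁^temp(𝒢)` are precisely the edge-like subgroups." [cite: MochizukiSemiAnbd2006, Thm 3.7(iv) p.41].

PROOF-ONLY instance file (abc-iut cell, layer L3, row «T37iv-S2@SPARSE-CLASS», file F10, seat abc-iut-L3-t8 gen 11;
no definition, no named fact).

* `SemiGraph.leafStar_sparse` — the leaf-star `𝔾⋆` is sparse: of the two branches of `e_n` one abuts to the leaf
  `n`, of valence one; hence `starOfLeaves_sparse` for EVERY leaf-star of groups, whatever the gluings;
* ★ `metabelianLeafStar_isCompact_or_anchored_canonical` — at the canonical chart of `𝒢⋆(p)` two compact subgroups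
  meeting non-trivially generate a compact subgroup or are anchored;
* ★ `metabelianLeafStar_inf_eq_bot_of_exotic_of_ne_canonical` / `metabelianLeafStar_verticial_of_ne_canonical` —
  gen 9's isolation of exotic maximal compact subgroups and SENTENCE 2 at `𝒢⋆(p)` (there proved from the
  `a`-character bookkeeping, `MetabelianLeafStarExoticIsolation.lean`, every chart) recovered at the canonical chart as
  instances of the SPARSE class theorems.

Honest framing: statements about OUR typed `π₁^temp` of OUR countable carrier `𝒢⋆(p)` (NOT locally finite; sentence 1
of Thm 3.7 (iv) FAILS there as typed, abc-iut-L3-t8 gen 7); print's Thm 3.7 concerns the graphs of [SemiAnbd];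
nothing here bears on [IUTchIII] Cor. 3.12; no side taken; typed ≠ proved.
-/
noncomputable section

open CategoryTheory Topology

namespace Literature.AnabelianGeometry.SemiGraphs

universe u

namespace SemiGraph

/-- **The leaf-star is sparse**: of two distinct branches of one edge `e_n` one is `β_n⁻ = (n, false)`, abutting to
the leaf `n`, whose star is the singleton `{β_n⁻}`. [cite: MochizukiSemiAnbd2006, §1 p.13] -/
theorem leafStar_sparse :
    ∀ (b b' : leafStar.Branch) (v v' : leafStar.Vertex), b ≠ b' → leafStar.edgeOf b = leafStar.edgeOf b' →
      leafStar.abuts b = some v → leafStar.abuts b' = some v' →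
      {c : leafStar.Branch | leafStar.abuts c = some v}.Finite ∨ {c : leafStar.Branch | leafStar.abuts c = some v'}.Finite := by
  rintro ⟨n, c⟩ ⟨n', c'⟩ v v' hne he hv hv'
  change n = n' at he
  subst he
  cases c with
  | false =>
    left
    have hvn : v = some n := (Option.some.inj hv).symm
    subst hvn
    exact leafStar_finite_star_some n
  | true =>
    cases c' with
    | false =>
      right
      have hvn : v' = some n := (Option.some.inj hv').symm
      subst hvn
      exact leafStar_finite_star_some n
    | true => exact absurd rfl hne

end SemiGraph

namespace ProfiniteSemiGraph

/-- **Every leaf-star of groups is sparse** (its base graph is `𝔾⋆`). [cite: MochizukiSemiAnbd2006, §1 p.13] -/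
theorem starOfLeaves_sparse (V : Option ℕ → Type) [∀ v, Group (V v)] [∀ v, TopologicalSpace (V v)]
    [∀ v, IsTopologicalGroup (V v)] [∀ v, CompactSpace (V v)] [∀ v, TotallyDisconnectedSpace (V v)]
    (E : Type) [Group E] [TopologicalSpace E] [IsTopologicalGroup E] [CompactSpace E] [TotallyDisconnectedSpace E]
    (up : ℕ → (E →ₜ* V none)) (low : ∀ n : ℕ, E →ₜ* V (some n)) :
    ∀ (b b' : (starOfLeaves V E up low).graph.Branch) (v v' : (starOfLeaves V E up low).graph.Vertex), b ≠ b' →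
      (starOfLeaves V E up low).graph.edgeOf b = (starOfLeaves V E up low).graph.edgeOf b' →
      (starOfLeaves V E up low).graph.abuts b = some v → (starOfLeaves V E up low).graph.abuts b' = some v' →
      {c : (starOfLeaves V E up low).graph.Branch | (starOfLeaves V E up low).graph.abuts c = some v}.Finite ∨
        {c : (starOfLeaves V E up low).graph.Branch | (starOfLeaves V E up low).graph.abuts c = some v'}.Finite :=
  SemiGraph.leafStar_sparse

variable (p : ℕ) [hp : Fact p.Prime]

/-- ★ **At the canonical chart of `𝒢⋆(p)` two compact subgroups meeting non-trivially generate a compact subgroup or are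
anchored** (instance of `isCompact_or_anchored_of_sparse`; the hypotheses of Thm 3.7 at `𝒢⋆(p)` are theorems,
`metabelianLeafStar_thm37Hypotheses'`). [cite: MochizukiSemiAnbd2006, Thm 3.7(iv) p.41] -/
theorem metabelianLeafStar_isCompact_or_anchored_canonical
    (K₁ K₂ : Subgroup (((metabelianLeafStar p).galoisLevelData
      (metabelianLeafStar_thm37Hypotheses' p).toProp36Hypotheses).temperedPi
      (metabelianLeafStar_thm37Hypotheses' p).toProp36Hypotheses.isCountable))
    (hK₁ : IsCompact (K₁ : Set (((metabelianLeafStar p).galoisLevelData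
      (metabelianLeafStar_thm37Hypotheses' p).toProp36Hypotheses).temperedPi
      (metabelianLeafStar_thm37Hypotheses' p).toProp36Hypotheses.isCountable)))
    (hK₂ : IsCompact (K₂ : Set (((metabelianLeafStar p).galoisLevelData
      (metabelianLeafStar_thm37Hypotheses' p).toProp36Hypotheses).temperedPi
      (metabelianLeafStar_thm37Hypotheses' p).toProp36Hypotheses.isCountable)))
    (hne : K₁ ⊓ K₂ ≠ ⊥) :
    IsCompact (((K₁ ⊔ K₂).topologicalClosure : Subgroup (((metabelianLeafStar p).galoisLevelData
      (metabelianLeafStar_thm37Hypotheses' p).toProp36Hypotheses).temperedPi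
      (metabelianLeafStar_thm37Hypotheses' p).toProp36Hypotheses.isCountable)) :
        Set (((metabelianLeafStar p).galoisLevelData
      (metabelianLeafStar_thm37Hypotheses' p).toProp36Hypotheses).temperedPi
      (metabelianLeafStar_thm37Hypotheses' p).toProp36Hypotheses.isCountable)) ∨
    ((∃ (v : (metabelianLeafStar p).graph.Vertex)
        (H : Subgroup ((metabelianLeafStar p).temperedPiChart (metabelianLeafStar_thm37Hypotheses' p).toProp36Hypotheses).G),
        H ∈ verticialSubgroups ((metabelianLeafStar p).temperedPiChart
          (metabelianLeafStar_thm37Hypotheses' p).toProp36Hypotheses) v ∧ K₁ ≤ H) ∧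
      (∃ (v : (metabelianLeafStar p).graph.Vertex)
        (H : Subgroup ((metabelianLeafStar p).temperedPiChart (metabelianLeafStar_thm37Hypotheses' p).toProp36Hypotheses).G),
        H ∈ verticialSubgroups ((metabelianLeafStar p).temperedPiChart
          (metabelianLeafStar_thm37Hypotheses' p).toProp36Hypotheses) v ∧ K₂ ≤ H) ∧
      ∃ (e : (metabelianLeafStar p).graph.Edge)
        (L : Subgroup ((metabelianLeafStar p).temperedPiChart (metabelianLeafStar_thm37Hypotheses' p).toProp36Hypotheses).G),
        L ∈ edgeLikeSubgroups ((metabelianLeafStar p).temperedPiChart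
          (metabelianLeafStar_thm37Hypotheses' p).toProp36Hypotheses) e ∧ K₁ ⊓ K₂ ≤ L) :=
  isCompact_or_anchored_of_sparse (metabelianLeafStar_thm37Hypotheses' p) (starOfLeaves_sparse _ _ _ _) K₁ K₂ hK₁ hK₂ hne

/-- ★ **Isolation at the canonical chart of `𝒢⋆(p)` by the generic route**: an exotic maximal compact subgroup meets
every other maximal compact subgroup trivially (gen 9's `metabelianLeafStar_inf_eq_bot_of_isMaximalCompactSubgroup_of_ne`
at the canonical chart, now an instance of `inf_eq_bot_of_isMaximalCompactSubgroup_of_exotic_of_ne_of_sparse`).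
[cite: MochizukiSemiAnbd2006, Thm 3.7(iv) p.41] -/
theorem metabelianLeafStar_inf_eq_bot_of_exotic_of_ne_canonical
    (K K₀ : Subgroup (((metabelianLeafStar p).galoisLevelData
      (metabelianLeafStar_thm37Hypotheses' p).toProp36Hypotheses).temperedPi
      (metabelianLeafStar_thm37Hypotheses' p).toProp36Hypotheses.isCountable))
    (hK : IsMaximalCompactSubgroup K) (hK₀ : IsMaximalCompactSubgroup K₀)
    (hK₀ex : ∀ (w : (metabelianLeafStar p).graph.Vertex)
      (H' : Subgroup ((metabelianLeafStar p).temperedPiChart (metabelianLeafStar_thm37Hypotheses' p).toProp36Hypotheses).G),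
      H' ∈ verticialSubgroups ((metabelianLeafStar p).temperedPiChart
        (metabelianLeafStar_thm37Hypotheses' p).toProp36Hypotheses) w → ¬ K₀ ≤ H')
    (hKK₀ : K ≠ K₀) : K ⊓ K₀ = ⊥ :=
  inf_eq_bot_of_isMaximalCompactSubgroup_of_exotic_of_ne_of_sparse (metabelianLeafStar_thm37Hypotheses' p)
    (starOfLeaves_sparse _ _ _ _) K K₀ hK hK₀ hK₀ex hKK₀

/-- ★ **Thm 3.7 (iv), SECOND SENTENCE, at the canonical chart of `𝒢⋆(p)` by the generic route**: two distinct maximal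
compact subgroups meeting non-trivially are verticial with edge-like intersection (instance of
`verticial_of_isMaximalCompactSubgroup_of_ne_of_sparse`). [cite: MochizukiSemiAnbd2006, Thm 3.7(iv) p.41] -/
theorem metabelianLeafStar_verticial_of_ne_canonical
    (K₁ K₂ : Subgroup (((metabelianLeafStar p).galoisLevelData
      (metabelianLeafStar_thm37Hypotheses' p).toProp36Hypotheses).temperedPi
      (metabelianLeafStar_thm37Hypotheses' p).toProp36Hypotheses.isCountable))
    (hK₁ : IsMaximalCompactSubgroup K₁) (hK₂ : IsMaximalCompactSubgroup K₂) (hne₁₂ : K₁ ≠ K₂) (hne : K₁ ⊓ K₂ ≠ ⊥) :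
    (∃ v : (metabelianLeafStar p).graph.Vertex, K₁ ∈ verticialSubgroups ((metabelianLeafStar p).temperedPiChart
        (metabelianLeafStar_thm37Hypotheses' p).toProp36Hypotheses) v) ∧
      (∃ v : (metabelianLeafStar p).graph.Vertex, K₂ ∈ verticialSubgroups ((metabelianLeafStar p).temperedPiChart
        (metabelianLeafStar_thm37Hypotheses' p).toProp36Hypotheses) v) ∧
      ∃ (e : (metabelianLeafStar p).graph.Edge)
        (L : Subgroup ((metabelianLeafStar p).temperedPiChart (metabelianLeafStar_thm37Hypotheses' p).toProp36Hypotheses).G),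
        L ∈ edgeLikeSubgroups ((metabelianLeafStar p).temperedPiChart
          (metabelianLeafStar_thm37Hypotheses' p).toProp36Hypotheses) e ∧ K₁ ⊓ K₂ ≤ L :=
  verticial_of_isMaximalCompactSubgroup_of_ne_of_sparse (metabelianLeafStar_thm37Hypotheses' p)
    (starOfLeaves_sparse _ _ _ _) K₁ K₂ hK₁ hK₂ hne₁₂ hne

end ProfiniteSemiGraph

end Literature.AnabelianGeometry.SemiGraphs

end
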